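/-
Copyright: the b2b-balaban cell (near-miss cell 7), T⁴-continuum fan-out; row NE7b ROUND-2 swarm, seat
t4-ne7b-formalise-leaf-04 (gen 9) — «SAT-LAWS» file A (journal INTENT l.18748; leaf-08 g11's first-refusal offer
F-leaf08g11-1 ∕ F2 (ii), l.17741 (3)): the PIECES law of this lineage's `HistoryZoneMassPiecesLaw` (gen 3, p214316) with
the evolution factor ABSTRACT, and its SATURATED instance over leaf-08 g11's `HistoryZoneEvolveSaturate` (p229704).
Released under the licence of the surrounding project.
-/
import Summits.QuantumFields.BalabanUV.T4Continuum.Support.HistoryZoneMassPiecesLaw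
import Summits.QuantumFields.BalabanUV.T4Continuum.Support.HistoryZoneEvolveSaturate

/-!
# Zone mass for PIECES with an ABSTRACT evolution factor, and the SATURATED law

Summits-side support leaf of the T⁴-continuum cell (rung (B)+1 on a FINITE torus only; NOT infinite volume, NOT the
mass gap, NOT the Clay statement; NOT a proof of the spine estimate NE7b).  Row NE7b, route «COUNT», row S6g′
«MASS-BASED SIBLING COUNT» step (a) = the cardinality law, in the service of the smallness census (rows S12n∕S12o,
finding F-leaf08g11-1 «the saturated collapse radius», ruling R-OWNER-23-15).  [folklore] structural recursion + linear
real arithmetic on OUR carriers; nothing is quoted from print, nothing printed is asserted, no `[cite:]` tag, no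
`Prop`-valued fact minted (trigger c1); every constant SYMBOLIC in `(d, L, c, ρ, C₁)`, the stride `s`, the level
advance `m` and the factor `A₁` (c2∕c6); no exit ∕ socket ∕ `HistoryConstants*` ∕ END file is touched (c3); SIBLING
module — no landed file is edited, nothing is re-plugged.

WHY.  The law of record `HistoryZoneMassPiecesLaw.card_zone_le_pieces` (p214316) prices the evolution of an
`s`-window by `HistoryZoneEvolveLevels.card_evolveD_le`, i.e. by the level-pattern-free factor
`(2·cth c 1 k + 1)^d ≤ A₁ := (2·cth c 1 s + 1)^d` (`cth c 1 s = s·(c+1)`) — the factor `N = (2·cth 32 1 sS + 1)^d` of the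
END of record's constant `Θ` (leaf-08 g11, l.17741).  Under the SAME level function the exact radius SATURATES at
`csat c L = 2(c+1) + 2(c+1)∕(L−1)` (`HistoryZoneEvolveSaturate.card_evolveD_le_sat`, p229704, k-FREE).  The law's proof
uses nothing about the factor except «evolved piece ≤ A₁ · #blocks (L^{lv (u+k) − lv u})» for windows `k ≤ s`, so it is
proved here ONCE for an abstract factor.

WHAT.  §1 **`card_zone_le_pieces_of_factor`** — p214316's statement and proof token for token, except: the factor is a
binder `{A₁ : ℝ} (hA₁0 : 0 ≤ A₁)` with the displayed EVOLUTION BOUND `hev : ∀ u k S, InRange (sideD n L K lv u) S →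
u + k ≤ K → k ≤ s → #evolveD n L K lv c u k S ≤ A₁ · #blocks (L^{lv (u+k) − lv u}) S`, the smallness reads
`A₁·5^d·ρ ≤ L^m∕2`, the conclusion `#(zone t X) ≤ zmass sh θ (2A₁C₁) (4(A₁5^d)) t X + 2(A₁5^d)` for every PIECE
`X ∈ parts sh tX G` (p214316's two proof lines `hcard`∕`hcth` become one application of `hev`; nothing else moves).
§2 the SATURATED LAW **`card_zone_le_pieces_sat`** (`2 ≤ L`, `A₁ := (2·csat c L + 1)^d`, `hev := card_evolveD_le_sat`),
`card_zone_le_pieces_half_sat` (`m := s∕2`), `card_zone_le_pieces_self_sat` (whole structure = birth or merger) — binder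
lists = p214316's `card_zone_le_pieces`∕`_half`∕`_self` with `hL : 2 ≤ L` and `cth c 1 s ↦ csat c L`, nothing else;
`hsmall_sat_of_record` (for `s ≥ 4` the record's smallness implies the saturated one).  §3 FIDELITY: the law of record
re-derived VERBATIM from §1 (`hev := hev_record` = `card_evolveD_le` + `cth_mono`) as an `example` — §1 provably
subsumes p214316 — and `card_zone_le_pieces_sat_of_record` (the saturated bound under the record's own hypotheses,
`s ≥ 4`, `L ≥ 2`).  §4 sanity.

CONSUMERS (not touched): `HistoryZoneMassCluster.card_regZoneD_le_pieces∕_self` (p217345; `_sat` twins = file B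
`HistoryZoneMassClusterSat`) → `HistoryJoinsPlacedLaws.facts_zoneP_of_ne_renew` → … → the twin END; NO re-plug of that
chain is proposed (census value booked R-OWNER-23-15: `N = 143⁴` instead of `2245⁴` at `(c, L, sS) = (32, 13, 34)`).

HONEST: a law about OUR levelled reading; the headline's Prop (p224237) and every ∃-threshold of the END of record are
UNCHANGED by this file; nothing of H3 ∕ (B) ∕ BetaPertHyp or of the nine discharged; NE7b NOT proved; spine 0∕9.
HONEST DEPENDENCY (cell): continuum YM on T⁴ ⇐ BetaPertH ∧ nine spine estimates (0/9 proved); BetaPertH ⇐ (D1) ∧ (D4)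
∧ CAP+tail; G-an2-4 gates asym, D1 and NE2/3/4.  This file changes none of it.
-/

open Finset
open Literature.MathematicalPhysics.QuantumFieldTheory.Balaban1983to89
open T4PersistenceDictionary T4PartnerMultiplicity
open Summit.QuantumFields.BalabanUV.T4Continuum
open PlacementSkeleton Crowding ZoneSkeleton ZoneTorus HistoryZones HistoryZoneMass HistoryZoneEvolve HistoryZoneMassLaw
open HistoryZoneEvolveLevels HistoryZoneMassLawLevels HistoryZoneMassPieces HistoryZoneMassPiecesLaw HistoryZoneEvolveSaturate

namespace Summit.QuantumFields.BalabanUV.T4Continuum.HistoryZoneMassLawFactor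

noncomputable section

variable {d : ℕ}

/-! ## §1 The law for pieces with an abstract evolution factor -/

section Law

variable {ε : Type*} [DecidableEq ε] {sh : ε → PEv} {n L K c : ℕ} {lv : ℕ → ℕ} {G : Gen ε}
  {zone : ℕ → Gen ε → Finset (Fin d → ℕ)}

/-- **THE CARDINALITY LAW AT LEVELS FOR PIECES, ABSTRACT EVOLUTION FACTOR** (row S6g′(a); slim reading, linked field
assumed and bound concluded for the pieces of `G` only — as p214316).  Hypotheses: `L ≥ 1`; a level function `lv`;
`ZoneStepsD`; chronology; the LINKED field for pieces (`ρ ≥ 1`); the BIRTH-CARDINALITY field (`C₁ ≥ 0`); a stride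
`s ≥ 1` with level advance `m`; a factor `A₁ ≥ 0` with the EVOLUTION BOUND `hev` (every `k ≤ s` levelled tolerant steps
of an in-range set cost at most `A₁` times its blocking by `L^{lv (u+k) − lv u}`); the smallness `A₁·5^d·ρ ≤ L^m∕2`; a
decay `0 ≤ θ ≤ 1` with `1∕2 ≤ θ^s`.  Conclusion, with `A := A₁·5^d`: every piece `X ∈ parts sh tX G` has
`#(zone t X) ≤ zmass sh θ (2A₁C₁) (4A) t X + 2A` for `t ∈ [ftime X, K]`. [folklore] -/
theorem card_zone_le_pieces_of_factor (hL : 1 ≤ L) (hlv : LevelFn K lv) (hR : ZoneStepsD sh n L K lv c G zone)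
    (hchr : Chrono (PEv.step ∘ sh) G) {ρ : ℕ} (hρ : 1 ≤ ρ)
    (hlink : ∀ (t t₀ : ℕ) (X : Gen ε), X ∈ parts sh t₀ G → ftime (PEv.step ∘ sh) X ≤ t → t ≤ K →
      Linked (sideD n L K lv t) ρ (zone t X))
    {C₁ : ℝ} (hC₁ : 0 ≤ C₁)
    (hbirth : ∀ (b : ε) (j : ℕ), Sub (Gen.born b j) G →
      ((zone (sh b).step (Gen.born b j)).card : ℝ) ≤ C₁ * (((sh b).fat : ℝ) + 1))
    {s m : ℕ} (hs : 1 ≤ s) (hm : ∀ u : ℕ, u + s ≤ K → lv u + m ≤ lv (u + s))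
    {A₁ : ℝ} (hA₁0 : 0 ≤ A₁)
    (hev : ∀ (u k : ℕ) (S : Finset (Fin d → ℕ)), InRange (sideD n L K lv u) S → u + k ≤ K → k ≤ s →
      ((evolveD n L K lv c u k S).card : ℝ) ≤ A₁ * ((blocks (L ^ (lv (u + k) - lv u)) S).card : ℝ))
    (hsmall : A₁ * (5 : ℝ) ^ d * ρ ≤ (L : ℝ) ^ m / 2)
    {θ : ℝ} (hθ0 : 0 ≤ θ) (hθ1 : θ ≤ 1) (hθs : 1 / 2 ≤ θ ^ s) :
    ∀ (t tX : ℕ) (X : Gen ε), X ∈ parts sh tX G → ftime (PEv.step ∘ sh) X ≤ t → t ≤ K →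
      ((zone t X).card : ℝ) ≤ zmass sh θ (2 * A₁ * C₁) (4 * (A₁ * (5 : ℝ) ^ d)) t X + 2 * (A₁ * (5 : ℝ) ^ d) := by
  -- names and signs of the constants
  set A : ℝ := A₁ * (5 : ℝ) ^ d with hA
  set WB : ℝ := 2 * A₁ * C₁ with hWB
  set WM : ℝ := 4 * A with hWM
  have hA0 : 0 ≤ A := by positivity
  have hWB0 : 0 ≤ WB := by positivity
  have hWM0 : 0 ≤ WM := by positivity
  have hL0 : (0 : ℝ) < L := by exact_mod_cast hL
  have hL1 : (1 : ℝ) ≤ L := by exact_mod_cast hL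
  have hLm : (0 : ℝ) < (L : ℝ) ^ m := by positivity
  have hρ0 : (0 : ℝ) ≤ ρ := by positivity
  set a : ℝ := A * ρ / (L : ℝ) ^ m with ha
  have ha0 : 0 ≤ a := by positivity
  have hahalf : a ≤ 1 / 2 := by rw [ha, div_le_iff₀ hLm]; linarith
  have haθ : a ≤ θ ^ s := hahalf.trans hθs
  -- strong induction on `t`
  intro t
  induction t using Nat.strong_induction_on with
  | _ t ih =>
  intro tX X hXp hft htK
  have hX : Sub X G := Sub.trans (sub_of_mem_parts tX hXp) (Sub.refl G)
  set t₀ := t + 1 - s with ht₀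
  have ht₀le : t₀ ≤ t + 1 := by omega
  have hdec := zone_subset_partsS hR hchr t₀ hX ht₀le hft htK
  have hchrX := chrono_of_sub (PEv.step ∘ sh) hX hchr
  -- the cost of one piece
  have piece : ∀ p ∈ parts sh t₀ X,
      ((evolveD n L K lv c (ustart sh t₀ p) (t - ustart sh t₀ p) (zone (ustart sh t₀ p) p)).card : ℝ) ≤
        zmass sh θ WB WM t p + (2 * a * A + A) := by
    intro p hp
    have hpX := sub_of_mem_parts t₀ hp
    have hpG : Sub p G := Sub.trans hpX hX
    obtain ⟨t₂, hp₂⟩ := parts_trans hXp hp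
    have hchrp := chrono_of_sub (PEv.step ∘ sh) hpX hchrX
    have hfp : ftime (PEv.step ∘ sh) p ≤ t := (ftime_le_of_sub _ hpX hchrX).trans hft
    have hfu : ftime (PEv.step ∘ sh) p ≤ ustart sh t₀ p := le_max_right _ _
    have hut : ustart sh t₀ p ≤ t := max_le (by omega) hfp
    have huK : ustart sh t₀ p ≤ K := hut.trans htK
    have hRu : InRange (sideD n L K lv (ustart sh t₀ p)) (zone (ustart sh t₀ p) p) := hR.inRange _ p hpG
    have hukK : ustart sh t₀ p + (t - ustart sh t₀ p) ≤ K := by rw [Nat.add_sub_cancel' hut]; exact htK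
    have hks : t - ustart sh t₀ p ≤ s := by
      have : t₀ - 1 ≤ ustart sh t₀ p := le_max_left _ _
      omega
    -- the ABSTRACT evolution factor (the one step that differs from p214316's proof)
    have h1 : ((evolveD n L K lv c (ustart sh t₀ p) (t - ustart sh t₀ p) (zone (ustart sh t₀ p) p)).card : ℝ) ≤
        A₁ * ((blocks (L ^ (lv t - lv (ustart sh t₀ p))) (zone (ustart sh t₀ p) p)).card : ℝ) := by
      have h := hev (ustart sh t₀ p) (t - ustart sh t₀ p) (zone (ustart sh t₀ p) p) hRu hukK hks
      rwa [Nat.add_sub_cancel' hut] at h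
    have hextra : 0 ≤ 2 * a * A + A := by positivity
    rcases parts_cases t₀ hp with hold | ⟨b, j, rfl, hbt⟩
    · -- an ANCESTOR: start `u = t − s`, `s` steps, level advance `≥ m`; linked set meets few `L^{Δlv}`-blocks; the
      -- induction hypothesis at `u`
      have hueq : ustart sh t₀ p = t - s := by
        show max (t₀ - 1) (ftime (PEv.step ∘ sh) p) = t - s
        rw [max_eq_left (by omega)]; omega
      have hkeq : t - (t - s) = s := by omega
      rw [hueq] at h1 hRu hfu huK ⊢
      rw [hkeq] at h1 ⊢
      set u := t - s with hu
      have hult : u < t := by omega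
      have hus : u + s ≤ K := by omega
      have hust : u + s = t := by omega
      have ihp := ih u hult t₂ p hp₂ hfu huK
      have hlk := hlink u t₂ p hp₂ hfu huK
      have hΔ : m ≤ lv t - lv u := by have := hm u hus; rw [hust] at this; omega
      have hSe : sideD n L K lv u = sideD n L K lv t * L ^ (lv t - lv u) := by
        have := sideD_add (n := n) (L := L) hlv hus; rwa [hust] at this
      have hRu' : InRange (sideD n L K lv t * L ^ (lv t - lv u)) (zone u p) := by rw [← hSe]; exact hRu
      have hlk' : Linked (sideD n L K lv t * L ^ (lv t - lv u)) ρ (zone u p) := by rw [← hSe]; exact hlk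
      have hbl := card_blocks_le_of_linked_real (Nat.one_le_pow _ _ hL) hρ hRu' hlk'
      have hz0 : (0 : ℝ) ≤ (ρ : ℝ) * ((zone u p).card : ℝ) := by positivity
      have hpow : (L : ℝ) ^ m ≤ (L : ℝ) ^ (lv t - lv u) := pow_le_pow_right₀ hL1 hΔ
      have hdiv : (ρ : ℝ) * ((zone u p).card : ℝ) / (L : ℝ) ^ (lv t - lv u) ≤
          (ρ : ℝ) * ((zone u p).card : ℝ) / (L : ℝ) ^ m := div_le_div_of_nonneg_left hz0 hLm hpow
      have hbl' : ((blocks (L ^ (lv t - lv u)) (zone u p)).card : ℝ) ≤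
          (5 : ℝ) ^ d * ((ρ : ℝ) * ((zone u p).card : ℝ) / (L : ℝ) ^ m + 1) := by
        have h := hbl
        push_cast at h
        exact h.trans (mul_le_mul_of_nonneg_left (by linarith) (by positivity))
      have h2 : A₁ * ((blocks (L ^ (lv t - lv u)) (zone u p)).card : ℝ) ≤ a * ((zone u p).card : ℝ) + A := by
        have h := mul_le_mul_of_nonneg_left hbl' hA₁0
        have e : A₁ * ((5 : ℝ) ^ d * ((ρ : ℝ) * ((zone u p).card : ℝ) / (L : ℝ) ^ m + 1)) =
            a * ((zone u p).card : ℝ) + A := by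
          rw [ha, hA]; ring
        linarith
      have h3 : a * ((zone u p).card : ℝ) ≤ a * (zmass sh θ WB WM u p + 2 * A) := mul_le_mul_of_nonneg_left ihp ha0
      have h4 : a * zmass sh θ WB WM u p ≤ zmass sh θ WB WM t p := by
        have h := mul_zmass_le (sh := sh) hθ0 hWB0 hWM0 ha0 haθ hchrp hfu (k := s)
        rwa [hust] at h
      linarith
    · -- a RECENT BIRTH: start `u = st b`, age `≤ s − 1`; `#blocks ≤ #zone (st b) ≤ C₁·(fat+1)`
      have hueq : ustart sh t₀ (Gen.born b j) = (sh b).step := by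
        show max (t₀ - 1) (sh b).step = (sh b).step
        exact max_eq_right (by omega)
      rw [hueq] at h1 ⊢
      set k := t - (sh b).step with hk
      have hks' : k ≤ s - 1 := by omega
      have hbl : ((blocks (L ^ (lv t - lv (sh b).step)) (zone (sh b).step (Gen.born b j))).card : ℝ) ≤
          C₁ * (((sh b).fat : ℝ) + 1) :=
        le_trans (by exact_mod_cast card_image_le) (hbirth b j hpG)
      have h2 : ((evolveD n L K lv c (sh b).step k (zone (sh b).step (Gen.born b j))).card : ℝ) ≤
          A₁ * (C₁ * (((sh b).fat : ℝ) + 1)) := h1.trans (mul_le_mul_of_nonneg_left hbl hA₁0)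
      have hpow : 1 / 2 ≤ θ ^ k := hθs.trans (pow_le_pow_of_le_one hθ0 hθ1 (by omega))
      have hz : zmass sh θ WB WM t (Gen.born b j) = WB * (((sh b).fat : ℝ) + 1) * θ ^ k := rfl
      rw [hz, hWB]
      have hf0 : 0 ≤ A₁ * (C₁ * (((sh b).fat : ℝ) + 1)) := by positivity
      have hcore : A₁ * (C₁ * (((sh b).fat : ℝ) + 1)) ≤ 2 * A₁ * C₁ * (((sh b).fat : ℝ) + 1) * θ ^ k := by
        nlinarith [mul_le_mul_of_nonneg_left hpow hf0]
      linarith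
  -- summing the pieces
  have hsum : ((zone t X).card : ℝ) ≤
      ((parts sh t₀ X).map fun p => zmass sh θ WB WM t p + (2 * a * A + A)).sum := by
    refine (le_trans (by exact_mod_cast card_le_card hdec) (card_lunion_le _)).trans ?_
    rw [List.map_map]
    exact sum_map_le_sum_map fun p hp => piece p hp
  rw [List.sum_map_add, sum_map_const] at hsum
  -- bookkeeping: pieces + recent mergers = whole; the piece count; the recent mergers' floor
  have hbook := zmass_parts (sh := sh) (θ := θ) (WB := WB) (WM := WM) t₀ t X
  have hlen : ((parts sh t₀ X).length : ℝ) ≤ (recN sh t₀ X : ℝ) + 1 := by exact_mod_cast length_parts_le t₀ X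
  have hrec := recN_mul_le_recM (sh := sh) hθ0 hθ1 hWM0 (t₀ := t₀) (t := t) (s := s) (by omega) hchrX hft
  have hpow : 1 / 2 ≤ θ ^ (s - 1) := hθs.trans (pow_le_pow_of_le_one hθ0 hθ1 (Nat.sub_le s 1))
  have hunit : 2 * a * A + A ≤ 2 * A := by nlinarith
  have hunit' : 2 * a * A + A ≤ WM * θ ^ (s - 1) := by
    rw [hWM]; nlinarith [mul_le_mul_of_nonneg_left hpow hA0]
  have hN0 : (0 : ℝ) ≤ recN sh t₀ X := Nat.cast_nonneg _
  have hfinal : ((parts sh t₀ X).length : ℝ) * (2 * a * A + A) ≤ recM sh θ WM t₀ t X + 2 * A := by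
    have h1 : ((parts sh t₀ X).length : ℝ) * (2 * a * A + A) ≤ ((recN sh t₀ X : ℝ) + 1) * (2 * a * A + A) :=
      mul_le_mul_of_nonneg_right hlen (by positivity)
    have h2 : (recN sh t₀ X : ℝ) * (2 * a * A + A) ≤ (recN sh t₀ X : ℝ) * (WM * θ ^ (s - 1)) :=
      mul_le_mul_of_nonneg_left hunit' hN0
    linarith
  linarith

end Law

/-! ## §2 The saturated law for pieces -/

section Saturated

variable {ε : Type*} [DecidableEq ε] {sh : ε → PEv} {n L K c : ℕ} {lv : ℕ → ℕ} {G : Gen ε}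
  {zone : ℕ → Gen ε → Finset (Fin d → ℕ)}

/-- **THE SATURATED CARDINALITY LAW FOR PIECES**: p214316's `card_zone_le_pieces` with the level-pattern-free radius
`cth c 1 s = s·(c+1)` replaced by leaf-08 g11's SATURATED radius `csat c L = 2(c+1) + 2(c+1)∕(L−1)` (stride-independent;
`L ≥ 2`): `A₁ := (2·csat c L + 1)^d`, `A := A₁·5^d`, smallness `A₁·5^d·ρ ≤ L^m∕2`, and for every piece
`#(zone t X) ≤ zmass sh θ (2A₁C₁) (4A) t X + 2A`.  Binder list = `card_zone_le_pieces`' with `hL : 2 ≤ L` and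
`cth c 1 s ↦ csat c L`, nothing else. [folklore] -/
theorem card_zone_le_pieces_sat (hL : 2 ≤ L) (hlv : LevelFn K lv) (hR : ZoneStepsD sh n L K lv c G zone)
    (hchr : Chrono (PEv.step ∘ sh) G) {ρ : ℕ} (hρ : 1 ≤ ρ)
    (hlink : ∀ (t t₀ : ℕ) (X : Gen ε), X ∈ parts sh t₀ G → ftime (PEv.step ∘ sh) X ≤ t → t ≤ K →
      Linked (sideD n L K lv t) ρ (zone t X))
    {C₁ : ℝ} (hC₁ : 0 ≤ C₁)
    (hbirth : ∀ (b : ε) (j : ℕ), Sub (Gen.born b j) G →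
      ((zone (sh b).step (Gen.born b j)).card : ℝ) ≤ C₁ * (((sh b).fat : ℝ) + 1))
    {s m : ℕ} (hs : 1 ≤ s) (hm : ∀ u : ℕ, u + s ≤ K → lv u + m ≤ lv (u + s))
    (hsmall : (((2 * csat c L + 1) ^ d : ℕ) : ℝ) * (5 : ℝ) ^ d * ρ ≤ (L : ℝ) ^ m / 2)
    {θ : ℝ} (hθ0 : 0 ≤ θ) (hθ1 : θ ≤ 1) (hθs : 1 / 2 ≤ θ ^ s) :
    ∀ (t tX : ℕ) (X : Gen ε), X ∈ parts sh tX G → ftime (PEv.step ∘ sh) X ≤ t → t ≤ K →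
      ((zone t X).card : ℝ) ≤
        zmass sh θ (2 * (((2 * csat c L + 1) ^ d : ℕ) : ℝ) * C₁)
            (4 * ((((2 * csat c L + 1) ^ d : ℕ) : ℝ) * (5 : ℝ) ^ d)) t X +
          2 * ((((2 * csat c L + 1) ^ d : ℕ) : ℝ) * (5 : ℝ) ^ d) :=
  card_zone_le_pieces_of_factor (le_of_lt hL) hlv hR hchr hρ hlink hC₁ hbirth hs hm (Nat.cast_nonneg _)
    (fun u _ _ hS hk _ => by exact_mod_cast card_evolveD_le_sat (c := c) hL hlv u hS hk) hsmall hθ0 hθ1 hθs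

/-- **THE SATURATED LAW FOR PIECES WITH THE HALF-STRIDE ADVANCE** (`m := s∕2`, no level-advance binder). [folklore] -/
theorem card_zone_le_pieces_half_sat (hL : 2 ≤ L) (hlv : LevelFn K lv) (hR : ZoneStepsD sh n L K lv c G zone)
    (hchr : Chrono (PEv.step ∘ sh) G) {ρ : ℕ} (hρ : 1 ≤ ρ)
    (hlink : ∀ (t t₀ : ℕ) (X : Gen ε), X ∈ parts sh t₀ G → ftime (PEv.step ∘ sh) X ≤ t → t ≤ K →
      Linked (sideD n L K lv t) ρ (zone t X))
    {C₁ : ℝ} (hC₁ : 0 ≤ C₁)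
    (hbirth : ∀ (b : ε) (j : ℕ), Sub (Gen.born b j) G →
      ((zone (sh b).step (Gen.born b j)).card : ℝ) ≤ C₁ * (((sh b).fat : ℝ) + 1))
    {s : ℕ} (hs : 1 ≤ s)
    (hsmall : (((2 * csat c L + 1) ^ d : ℕ) : ℝ) * (5 : ℝ) ^ d * ρ ≤ (L : ℝ) ^ (s / 2) / 2)
    {θ : ℝ} (hθ0 : 0 ≤ θ) (hθ1 : θ ≤ 1) (hθs : 1 / 2 ≤ θ ^ s) :
    ∀ (t tX : ℕ) (X : Gen ε), X ∈ parts sh tX G → ftime (PEv.step ∘ sh) X ≤ t → t ≤ K →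
      ((zone t X).card : ℝ) ≤
        zmass sh θ (2 * (((2 * csat c L + 1) ^ d : ℕ) : ℝ) * C₁)
            (4 * ((((2 * csat c L + 1) ^ d : ℕ) : ℝ) * (5 : ℝ) ^ d)) t X +
          2 * ((((2 * csat c L + 1) ^ d : ℕ) : ℝ) * (5 : ℝ) ^ d) :=
  card_zone_le_pieces_sat hL hlv hR hchr hρ hlink hC₁ hbirth hs (fun u _ => levelFn_add_half_le hlv u s) hsmall hθ0 hθ1
    hθs

/-- **THE SATURATED LAW FOR THE WHOLE STRUCTURE** when it is a birth or a merger (its own piece for the cut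
`ftime G + 1`). [folklore] -/
theorem card_zone_le_pieces_self_sat (hL : 2 ≤ L) (hlv : LevelFn K lv) (hR : ZoneStepsD sh n L K lv c G zone)
    (hchr : Chrono (PEv.step ∘ sh) G) {ρ : ℕ} (hρ : 1 ≤ ρ)
    (hlink : ∀ (t t₀ : ℕ) (X : Gen ε), X ∈ parts sh t₀ G → ftime (PEv.step ∘ sh) X ≤ t → t ≤ K →
      Linked (sideD n L K lv t) ρ (zone t X))
    {C₁ : ℝ} (hC₁ : 0 ≤ C₁)
    (hbirth : ∀ (b : ε) (j : ℕ), Sub (Gen.born b j) G →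
      ((zone (sh b).step (Gen.born b j)).card : ℝ) ≤ C₁ * (((sh b).fat : ℝ) + 1))
    {s m : ℕ} (hs : 1 ≤ s) (hm : ∀ u : ℕ, u + s ≤ K → lv u + m ≤ lv (u + s))
    (hsmall : (((2 * csat c L + 1) ^ d : ℕ) : ℝ) * (5 : ℝ) ^ d * ρ ≤ (L : ℝ) ^ m / 2)
    {θ : ℝ} (hθ0 : 0 ≤ θ) (hθ1 : θ ≤ 1) (hθs : 1 / 2 ≤ θ ^ s)
    (hG : ∀ (Y : Gen ε) (e : ε) (h : ℕ), G ≠ Gen.renew Y e h) :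
    ∀ t : ℕ, ftime (PEv.step ∘ sh) G ≤ t → t ≤ K →
      ((zone t G).card : ℝ) ≤
        zmass sh θ (2 * (((2 * csat c L + 1) ^ d : ℕ) : ℝ) * C₁)
            (4 * ((((2 * csat c L + 1) ^ d : ℕ) : ℝ) * (5 : ℝ) ^ d)) t G +
          2 * ((((2 * csat c L + 1) ^ d : ℕ) : ℝ) * (5 : ℝ) ^ d) := by
  intro t hft htK
  have hself : G ∈ parts sh (ftime (PEv.step ∘ sh) G + 1) G := by
    cases G with
    | born b j => exact self_mem_parts_born b j _
    | renew Y e h => exact absurd rfl (hG Y e h)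
    | merge A B e => exact self_mem_parts_merge A B (Nat.lt_succ_self _)
  exact card_zone_le_pieces_sat hL hlv hR hchr hρ hlink hC₁ hbirth hs hm hsmall hθ0 hθ1 hθs t _ G hself hft htK

/-- the SATURATED factor is never worse than the law of record's from four-step strides on: for `s ≥ 4`,
`(2·csat c L + 1)^d ≤ (2·cth c 1 s + 1)^d` — so p214316's smallness `hsmall` IMPLIES §2's (cast form). [folklore] -/
theorem sat_factor_le_record_factor {s : ℕ} (hs : 4 ≤ s) (c L d : ℕ) :
    (((2 * csat c L + 1) ^ d : ℕ) : ℝ) ≤ (((2 * cth c 1 s + 1) ^ d : ℕ) : ℝ) := by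
  have h := csat_le_cth_one hs c L
  exact_mod_cast Nat.pow_le_pow_left (by omega) d

/-- … hence the law of record's smallness at a stride `s ≥ 4` yields the saturated law's smallness. [folklore] -/
theorem hsmall_sat_of_record {s m ρ : ℕ} (hs : 4 ≤ s) {c L d : ℕ}
    (hsmall : (((2 * cth c 1 s + 1) ^ d : ℕ) : ℝ) * (5 : ℝ) ^ d * ρ ≤ (L : ℝ) ^ m / 2) :
    (((2 * csat c L + 1) ^ d : ℕ) : ℝ) * (5 : ℝ) ^ d * ρ ≤ (L : ℝ) ^ m / 2 :=
  le_trans (mul_le_mul_of_nonneg_right (mul_le_mul_of_nonneg_right (sat_factor_le_record_factor hs c L d)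
    (by positivity)) (Nat.cast_nonneg _)) hsmall

end Saturated

/-! ## §3 Fidelity: the law of record is the instance `A₁ := (2·cth c 1 s + 1)^d` of §1 -/

section Fidelity

variable {ε : Type*} [DecidableEq ε] {sh : ε → PEv} {n L K c : ℕ} {lv : ℕ → ℕ} {G : Gen ε}
  {zone : ℕ → Gen ε → Finset (Fin d → ℕ)}

/-- the law of record's evolution bound in §1's `hev` shape: `card_evolveD_le` + `cth_mono` on a window `k ≤ s`
[folklore] -/
theorem hev_record (hL : 1 ≤ L) (hlv : LevelFn K lv) (s : ℕ) :
    ∀ (u k : ℕ) (S : Finset (Fin d → ℕ)), InRange (sideD n L K lv u) S → u + k ≤ K → k ≤ s →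
      ((evolveD n L K lv c u k S).card : ℝ) ≤
        (((2 * cth c 1 s + 1) ^ d : ℕ) : ℝ) * ((blocks (L ^ (lv (u + k) - lv u)) S).card : ℝ) := by
  intro u k S hS hk hks
  have h := card_evolveD_le (c := c) hL hlv u hS hk
  have hcth : (((2 * cth c 1 k + 1) ^ d : ℕ) : ℝ) ≤ (((2 * cth c 1 s + 1) ^ d : ℕ) : ℝ) := by
    have hmn := cth_mono c 1 hks
    exact_mod_cast Nat.pow_le_pow_left (by omega) d
  calc ((evolveD n L K lv c u k S).card : ℝ)
      ≤ (((2 * cth c 1 k + 1) ^ d : ℕ) : ℝ) * ((blocks (L ^ (lv (u + k) - lv u)) S).card : ℝ) := by exact_mod_cast h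
    _ ≤ (((2 * cth c 1 s + 1) ^ d : ℕ) : ℝ) * ((blocks (L ^ (lv (u + k) - lv u)) S).card : ℝ) :=
        mul_le_mul_of_nonneg_right hcth (Nat.cast_nonneg _)

/-- **FIDELITY**: the statement of the law of record `HistoryZoneMassPiecesLaw.card_zone_le_pieces` (p214316), copied
VERBATIM, follows from §1 with `hev := hev_record` — the abstract law subsumes it. -/
example (hL : 1 ≤ L) (hlv : LevelFn K lv) (hR : ZoneStepsD sh n L K lv c G zone)
    (hchr : Chrono (PEv.step ∘ sh) G) {ρ : ℕ} (hρ : 1 ≤ ρ)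
    (hlink : ∀ (t t₀ : ℕ) (X : Gen ε), X ∈ parts sh t₀ G → ftime (PEv.step ∘ sh) X ≤ t → t ≤ K →
      Linked (sideD n L K lv t) ρ (zone t X))
    {C₁ : ℝ} (hC₁ : 0 ≤ C₁)
    (hbirth : ∀ (b : ε) (j : ℕ), Sub (Gen.born b j) G →
      ((zone (sh b).step (Gen.born b j)).card : ℝ) ≤ C₁ * (((sh b).fat : ℝ) + 1))
    {s m : ℕ} (hs : 1 ≤ s) (hm : ∀ u : ℕ, u + s ≤ K → lv u + m ≤ lv (u + s))
    (hsmall : (((2 * cth c 1 s + 1) ^ d : ℕ) : ℝ) * (5 : ℝ) ^ d * ρ ≤ (L : ℝ) ^ m / 2)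
    {θ : ℝ} (hθ0 : 0 ≤ θ) (hθ1 : θ ≤ 1) (hθs : 1 / 2 ≤ θ ^ s) :
    ∀ (t tX : ℕ) (X : Gen ε), X ∈ parts sh tX G → ftime (PEv.step ∘ sh) X ≤ t → t ≤ K →
      ((zone t X).card : ℝ) ≤
        zmass sh θ (2 * (((2 * cth c 1 s + 1) ^ d : ℕ) : ℝ) * C₁)
            (4 * ((((2 * cth c 1 s + 1) ^ d : ℕ) : ℝ) * (5 : ℝ) ^ d)) t X +
          2 * ((((2 * cth c 1 s + 1) ^ d : ℕ) : ℝ) * (5 : ℝ) ^ d) :=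
  card_zone_le_pieces_of_factor hL hlv hR hchr hρ hlink hC₁ hbirth hs hm (Nat.cast_nonneg _) (hev_record hL hlv s)
    hsmall hθ0 hθ1 hθs

/-- at a stride `s ≥ 4` the SATURATED law holds under the law of record's OWN smallness (and `L ≥ 2`): the saturated
bound is then a free improvement of every consumer's constant. [folklore] -/
theorem card_zone_le_pieces_sat_of_record (hL : 2 ≤ L) (hlv : LevelFn K lv) (hR : ZoneStepsD sh n L K lv c G zone)
    (hchr : Chrono (PEv.step ∘ sh) G) {ρ : ℕ} (hρ : 1 ≤ ρ)
    (hlink : ∀ (t t₀ : ℕ) (X : Gen ε), X ∈ parts sh t₀ G → ftime (PEv.step ∘ sh) X ≤ t → t ≤ K →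
      Linked (sideD n L K lv t) ρ (zone t X))
    {C₁ : ℝ} (hC₁ : 0 ≤ C₁)
    (hbirth : ∀ (b : ε) (j : ℕ), Sub (Gen.born b j) G →
      ((zone (sh b).step (Gen.born b j)).card : ℝ) ≤ C₁ * (((sh b).fat : ℝ) + 1))
    {s m : ℕ} (hs : 4 ≤ s) (hm : ∀ u : ℕ, u + s ≤ K → lv u + m ≤ lv (u + s))
    (hsmall : (((2 * cth c 1 s + 1) ^ d : ℕ) : ℝ) * (5 : ℝ) ^ d * ρ ≤ (L : ℝ) ^ m / 2)
    {θ : ℝ} (hθ0 : 0 ≤ θ) (hθ1 : θ ≤ 1) (hθs : 1 / 2 ≤ θ ^ s) :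
    ∀ (t tX : ℕ) (X : Gen ε), X ∈ parts sh tX G → ftime (PEv.step ∘ sh) X ≤ t → t ≤ K →
      ((zone t X).card : ℝ) ≤
        zmass sh θ (2 * (((2 * csat c L + 1) ^ d : ℕ) : ℝ) * C₁)
            (4 * ((((2 * csat c L + 1) ^ d : ℕ) : ℝ) * (5 : ℝ) ^ d)) t X +
          2 * ((((2 * csat c L + 1) ^ d : ℕ) : ℝ) * (5 : ℝ) ^ d) :=
  card_zone_le_pieces_sat hL hlv hR hchr hρ hlink hC₁ hbirth (le_trans (by norm_num) hs) hm
    (hsmall_sat_of_record hs hsmall) hθ0 hθ1 hθs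

end Fidelity

/-! ## §4 Sanity (decided ∕ closed instances; the only numerals of this file) -/

namespace Sanity

/-- the two factors at the cell's letters `(c, L) = (32, 13)` and the minimal stride of record `s = 34`, for `d = 1`:
saturated `2·71 + 1 = 143` against `2·1122 + 1 = 2245` (decided) -/
example : 2 * csat 32 13 + 1 = 143 ∧ 2 * cth 32 1 34 + 1 = 2245 := by decide

end Sanity

end

end Summit.QuantumFields.BalabanUV.T4Continuum.HistoryZoneMassLawFactor
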